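import Summits.BirchSwinnertonDyer.BirchSwinnertonDyer.Theorems.KolyvaginRankRigidityAtTwoChebotarevWindowPrimeAtTwo
import HarnessLib

/-!
# Crux V2♭θ / V2♭∞ (stmt-BirchSwinnertonDyer-27220; line `kolyvagin_depth_split`), stub S1 — the pair
# Čebotarev at `2` keeping Gross's Frobenius condition

`exists_kolyvaginPrime_notMem_pair_frob`: the width seat's order-free pair Čebotarev
`exists_kolyvaginPrime_notMem_pair_of_heegner` for two NON-ZERO eigenclasses, with the conclusion
`FrobEqFrobInfty W K (2^{M'}) q` of `exists_kolyvaginPrime_gt_two_eigenclass_pair_of_le` kept (it is the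
input of the local pairing estimate `kummer_eval_pow_smul_ne_zero_at_two` at the fresh prime). HONEST
FRAMING: a repackaging; nothing here proves S1, V2♭θ or BSD.
-/

set_option autoImplicit false
set_option linter.dupNamespace false

noncomputable section

open scoped Classical
open Function NumberField IsDedekindDomain WeierstrassCurve Field
open Literature.NumberTheory.EllipticCurves Literature.NumberTheory.GaloisRepresentations

namespace Summit.BirchSwinnertonDyer.BirchSwinnertonDyer.Theorems.KolyvaginLowerBoundAtTwo

variable {K : Type} [Field K] [NumberField K] (W : WeierstrassCurve ℚ) [W.IsElliptic]
  [W.IsGloballyMinimal] [NeZero (W.conductorNorm ℤ)]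

/-- **New window prime at `2` for two NON-ZERO eigenclasses, order-free, WITH `Frob_q = Frob_∞` in
`Gal(K(E[2^{M'}])/ℚ)`** — the width seat's `exists_kolyvaginPrime_notMem_pair_of_heegner` with the
Frobenius conclusion of `exists_kolyvaginPrime_gt_two_eigenclass_pair_of_le` kept.
[cite: McCallumLMS1991, §5 (proof of Prop. 5.2), §3 Cor. 3.2] [cite: GrossLMS1991, §3 (3.2)] -/
theorem exists_kolyvaginPrime_notMem_pair_frob
    (hρ : ∀ n : ℕ, W.HasSurjectiveModNGaloisRep (2 ^ n : ℕ)) (hK : IsImaginaryQuadratic K)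
    (h2d : ¬ ((2 : ℤ) ∣ NumberField.discr K))
    (hH : SatisfiesHeegnerHypothesis (W.conductorNorm ℤ) K) {c : K ≃ₐ[ℚ] K} (hc : c ≠ 1)
    {M M' : ℕ} (hM : 1 ≤ M) (hMM' : M ≤ M')
    (κ₁ κ₂ : galH1Torsion (W.baseChange K) ((2 ^ M : ℕ) : ℤ)) (h1 : κ₁ ≠ 0) (h2 : κ₂ ≠ 0)
    {ε₁ ε₂ : ℤ} (hε₁ : ε₁ = 1 ∨ ε₁ = -1) (hε₂ : ε₂ = 1 ∨ ε₂ = -1)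
    (hκ₁ : conjAct W c ((2 ^ M : ℕ) : ℤ) κ₁ = ε₁ • κ₁)
    (hκ₂ : conjAct W c ((2 ^ M : ℕ) : ℤ) κ₂ = ε₂ • κ₂) (S : Finset ℕ) :
    ∃ q : ℕ, q ∉ S ∧ Zhang2014.IsKolyvaginPrime (W.conductorNorm ℤ) W K 2 q ∧
      M' ≤ Zhang2014.kolyvaginIndex W 2 q ∧ FrobEqFrobInfty W K (2 ^ M') q ∧
      ∃ v : HeightOneSpectrum (𝓞 K), ((q : ℕ) : 𝓞 K) ∈ v.asIdeal ∧
        (∀ j : ℕ, ((2 ^ (j + 2) : ℕ) : ℤ) • κ₁ ≠ 0 →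
          ((2 ^ j : ℕ) : ℤ) • κ₁ ∉
            (W.baseChange K).torsionLocalKer (v.adicCompletion K) ((2 ^ M : ℕ) : ℤ)) ∧
        (∀ j : ℕ, ((2 ^ (j + 2) : ℕ) : ℤ) • κ₂ ≠ 0 →
          ((2 ^ j : ℕ) : ℤ) • κ₂ ∉
            (W.baseChange K).torsionLocalKer (v.adicCompletion K) ((2 ^ M : ℕ) : ℤ)) := by
  classical
  obtain ⟨m₁, hkill₁, hm₁⟩ := exists_exponent_two W K h1
  obtain ⟨m₂, hkill₂, hm₂⟩ := exists_exponent_two W K h2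
  have hns := not_isSquare_discr_mul_Δ_of_heegner W (by simpa using hρ 1) hK h2d hH
  obtain ⟨q, hbq, hkoly, hidx, hfrob, hloc⟩ := exists_kolyvaginPrime_gt_two_eigenclass_pair_of_le
    (N := W.conductorNorm ℤ) hK hns hρ hc hM hMM' κ₁ κ₂ hε₁ hε₂ hκ₁ hκ₂ hm₁ hm₂ (S.sup id)
  have hqS : q ∉ S := fun h ↦ by
    have := Finset.le_sup (f := id) h
    simp only [id_eq] at this
    omega
  obtain ⟨v, hv⟩ := exists_natCast_mem_of_isKolyvaginPrime (W := W) hkoly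
  exact ⟨q, hqS, hkoly, hidx, hfrob, v, hv,
    orderFree_of_exponent W K hkill₁ (fun j hj ↦ (hloc v hv).1 j hj),
    orderFree_of_exponent W K hkill₂ (fun j hj ↦ (hloc v hv).2 j hj)⟩

end Summit.BirchSwinnertonDyer.BirchSwinnertonDyer.Theorems.KolyvaginLowerBoundAtTwo

end
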